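import Literature.Algebra.EuclideanLattices.GapCVPVerifier
import Summits.PneNP.PneNP.Theses.LatticeMagic

/-!
# Route LatticeMagic — support item `GapCVPInPromiseNP` (stmt-PneNP-10712)

`GapCVP_γ ∈ PromiseNP` for every factor `γ ≥ 1` [Aharonov–Regev 2005, §1 p. 2: "containment
in NP is trivial" — a witness for `dist(t, L(B)) ≤ d` is a lattice vector `u` with `‖t − u‖ ≤ d`;
Micciancio–Goldwasser 2002, Ch. 1 §1.2].

The route decl `Summit.PneNP.PneNP.Theses.LatticeMagic.GapCVPInPromiseNP` is, verbatim, the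
definiens of the named fact `Literature.Algebra.EuclideanLattices.gapCVP_mem_promiseNP`
(`LatticeGapCVPNPcoNP.lean`) with `gapCVPPromise γ` unfolded to
`PromiseProblem.ofEncoding gapCVPInstanceEncoding (GapCVP.yes γ) (GapCVP.no γ)` (definitionally
equal), and that fact is PROVED in the tree by
`Literature.Algebra.EuclideanLattices.gapCVP_mem_promiseNP_holds` (`GapCVPVerifier.lean`: the
`TM2` verifier "`‖z B − t‖² ≤ d²`" is in `P`, and a closest vector has coefficients of polynomial
bit size by Cramer/Hadamard). The item exists only so that the route file need not import the
verifier development; here imports are free, so the proof is the one-line `exact`.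
-/

set_option linter.dupNamespace false -- `Summit.PneNP.PneNP.…`: summit = sub-problem (D-0017)

namespace Summit.PneNP.PneNP.Theorems

/-- **`GapCVPInPromiseNP` holds** (route `LatticeMagic`, item stmt-PneNP-10712): for every
factor `γ : ℕ → ℝ` with `γ n ≥ 1` for all `n`, the promise problem `GapCVP_γ`
(`PromiseProblem.ofEncoding gapCVPInstanceEncoding (GapCVP.yes γ) (GapCVP.no γ)`) lies in
`PromiseNP` — the proved tree fact `Literature.Algebra.EuclideanLattices.gapCVP_mem_promiseNP_holds`
[Aharonov–Regev 2005, §1 p. 2 and Thm. 1.1; Micciancio–Goldwasser 2002, Ch. 1 §1.2]. -/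
theorem gapCVPInPromiseNP_proof : Summit.PneNP.PneNP.Theses.LatticeMagic.GapCVPInPromiseNP := by
  unfold Summit.PneNP.PneNP.Theses.LatticeMagic.GapCVPInPromiseNP
  exact Literature.Algebra.EuclideanLattices.gapCVP_mem_promiseNP_holds

end Summit.PneNP.PneNP.Theorems
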